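import Mathlib.LinearAlgebra.BilinearMap
import Mathlib.Algebra.Module.Submodule.Basic
import Mathlib.Data.Rat.Cast.CharZero
import HarnessLib

/-!
# Weil-type family coverage — (R4) of the placement law, lattice form: `m · Λ_B^∨ ⊆ Λ_B`

research route conditional on HC_CM; not a corollary; Q11.4-sentence-2 already refuted in dim ≥ 3.

Ring 2, WEIL-TYPE FAMILY-COVERAGE CENSUS (`HOME/WEIL-FAMILY-COVERAGE.md` §b04.5 (R4) / §b04.6, split-special-fibre
column, owner ring2-b04). Refinement (R4) of the placement law says: if the abelian subvariety `P = A^ε ⊆ (J, Θ)` is cut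
out by a SYMMETRIC idempotent `ε` with `m ε ∈ End(J)` (e.g. `|G|·ε ∈ ℤ[G]`, or `6 ε_B ∈ ℤ[σ]` for the primitive part of
a `ℤ/6`-cover), then the exponent of `Θ|_P` divides `m`, so every elementary divisor `dᵢ` of the induced polarisation
divides `m` ([LR22 §2.5 «the smallest such integer is the exponent»] = [BL Norm-endomorphism Criterion 5.3.4]).
The lattice content of that sentence is proved here, with the abelian variety replaced by its period lattice:

* `Ring2.WeilCoverage.smul_mem_of_isCompl_idempotent` — bookkeeping used twice in the ℤ/6 TYPE THEOREM of b04.6 P.S.: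
  if an idempotent `e` of `V` has `k • e` integral on a lattice `M`, then `k • M ⊆ (M ∩ ker e) + (M ∩ range e)`, i.e.
  the index `[M : (M ∩ ker e) ⊕ (M ∩ im e)]` divides a power of `k`;
* `Ring2.WeilCoverage.smul_mem_lattice_of_dual` — **(R4)**: `Λ ⊆ V` a lattice on which the form `E` is UNIMODULAR
  (every functional integral on `Λ` is `E(w, ·)`, `w ∈ Λ`) and non-degenerate, `e` an `E`-self-adjoint idempotent with
  `m • e` integral on `Λ`; then every `v ∈ im e` that pairs integrally with `Λ_B := Λ ∩ im e` has `m • v ∈ Λ_B` — the dual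
  of `(Λ_B, E)` sits inside `(1/m) Λ_B`, so the elementary divisors of `E|_{Λ_B}` divide `m`.

Pure linear algebra over `ℤ ⊂ ℚ`; no `def`, no named fact, no `sorry`; nothing here concerns Hodge classes.
References: [cite: Lange2023AbelianVarietiesComplex, §1.1.2 and §2.4 (norm endomorphism, exponent)];
Birkenhake–Lange, *Complex Abelian Varieties* §5.3 (Criterion 5.3.4); Lange–Rodríguez LNM 2310 §2.5.
-/

set_option linter.dupNamespace false

namespace Summit.HodgeConjecture.HodgeConjecture.Ring2.WeilCoverage

variable {V : Type*} [AddCommGroup V] [Module ℚ V]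

/-- **Index bookkeeping for an idempotent.** If `e : V → V` is idempotent and `k • e` maps the `ℤ`-submodule `M`
into itself, then `k • x ∈ (M ∩ ker e) + (M ∩ im e)` for every `x ∈ M` (write `k x = (k x - k e x) + k e x`).
Used in b04.6 P.S. with `k = 3` (separating `V₂ ⊕ V₆` on the `σ³ = -1` part) and `k = 2` (separating `V₃ ⊕ V₆`).
research route conditional on HC_CM; not a corollary; Q11.4-sentence-2 already refuted in dim ≥ 3. [folklore] -/
theorem smul_mem_of_isCompl_idempotent (M : Submodule ℤ V) (e : V →ₗ[ℚ] V) (he : e ∘ₗ e = e) (k : ℤ)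
    (hk : ∀ x ∈ M, (k : ℚ) • e x ∈ M) {x : V} (hx : x ∈ M) :
    ∃ y z : V, y ∈ M ∧ e y = 0 ∧ z ∈ M ∧ z ∈ LinearMap.range e ∧ (k : ℚ) • x = y + z := by
  have hkx : (k : ℚ) • x ∈ M := by
    rw [Int.cast_smul_eq_zsmul]
    exact M.smul_mem k hx
  refine ⟨(k : ℚ) • x - (k : ℚ) • e x, (k : ℚ) • e x, M.sub_mem hkx (hk x hx), ?_, hk x hx,
    ⟨(k : ℚ) • x, by rw [map_smul]⟩, (sub_add_cancel _ _).symm⟩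
  have hee : e (e x) = e x := by
    have := LinearMap.congr_fun he x
    simpa using this
  rw [map_sub, map_smul, map_smul, hee, sub_self]

/-- **(R4) in lattice form: `m · Λ_B^∨ ⊆ Λ_B`.** Let `E` be a bilinear form on the `ℚ`-space `V`, `Λ ⊆ V` a
`ℤ`-submodule on which `E` is UNIMODULAR in the sense that every `ℚ`-linear functional that is integral on `Λ` is
`E(w, ·)` for some `w ∈ Λ` (this packages «`Λ` spans `V`» and «`E|_Λ` is a perfect pairing»), and non-degenerate; let
`e` be an idempotent, self-adjoint for `E`, with `m • e` integral on `Λ`. Then every `v` in the image of `e` that pairs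
integrally with `Λ_B := Λ ∩ im e` satisfies `m • v ∈ Λ` (hence `∈ Λ_B`). Consequently the dual lattice of `(Λ_B, E)` lies
in `(1/m) Λ_B` and every elementary divisor of `E|_{Λ_B}` divides `m` — for `P = A^ε ⊆ (J, Θ)` with `Θ` principal and
`m ε ∈ End J` this is «the exponent `e(P)` divides `m`».
research route conditional on HC_CM; not a corollary; Q11.4-sentence-2 already refuted in dim ≥ 3.
[cite: Lange2023AbelianVarietiesComplex, §2.4 (norm endomorphism and exponent of an abelian subvariety)] -/
theorem smul_mem_lattice_of_dual (Λ : Submodule ℤ V) (E : V →ₗ[ℚ] V →ₗ[ℚ] ℚ)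
    (hunimod : ∀ g : V →ₗ[ℚ] ℚ, (∀ x ∈ Λ, ∃ n : ℤ, g x = n) → ∃ w ∈ Λ, ∀ y, g y = E w y)
    (hnondeg : ∀ u : V, (∀ y, E u y = 0) → u = 0)
    (e : V →ₗ[ℚ] V) (he : e ∘ₗ e = e) (hadj : ∀ u y, E (e u) y = E u (e y))
    (m : ℤ) (hm : ∀ x ∈ Λ, (m : ℚ) • e x ∈ Λ)
    {v : V} (hv : e v = v) (hint : ∀ x ∈ Λ, e x = x → ∃ n : ℤ, E v x = n) :
    (m : ℚ) • v ∈ Λ ∧ e ((m : ℚ) • v) = (m : ℚ) • v := by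
  have hee : ∀ x, e (e x) = e x := fun x => by
    have := LinearMap.congr_fun he x
    simpa using this
  -- the functional `y ↦ E(v, m e y)` is integral on `Λ`
  let g : V →ₗ[ℚ] ℚ := (m : ℚ) • (E v ∘ₗ e)
  have hg : ∀ x ∈ Λ, ∃ n : ℤ, g x = n := by
    intro x hx
    obtain ⟨n, hn⟩ := hint ((m : ℚ) • e x) (hm x hx) (by rw [map_smul, hee])
    refine ⟨n, ?_⟩
    simp only [g, LinearMap.smul_apply, LinearMap.coe_comp, Function.comp_apply, smul_eq_mul]
    rw [← hn, map_smul, smul_eq_mul]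
  obtain ⟨w, hwΛ, hw⟩ := hunimod g hg
  -- `E(w, y) = E(m v, y)` for all `y`, by self-adjointness and `e v = v`
  have hwv : w = (m : ℚ) • v := by
    have h0 : ∀ y, E (w - (m : ℚ) • v) y = 0 := by
      intro y
      rw [map_sub, LinearMap.sub_apply, ← hw y, map_smul, LinearMap.smul_apply]
      simp only [LinearMap.smul_apply, LinearMap.coe_comp, Function.comp_apply, smul_eq_mul]
      rw [← hadj, hv, sub_self]
    exact sub_eq_zero.mp (hnondeg _ h0)
  refine ⟨hwv ▸ hwΛ, ?_⟩
  rw [map_smul, hv]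

end Summit.HodgeConjecture.HodgeConjecture.Ring2.WeilCoverage
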